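import Summits.FinalStateConjecture.FinalStateConjecture.Theses.StarvedNecks
import Summits.FinalStateConjecture.FinalStateConjecture.Theorems.StarvedNecksNecksCertifyStubSeamFlatRestrict
import Literature.Geometry.Lorentzian.KerrConvergenceProofs

/-!
# `NecksCertify` (crux stmt-FinalStateConjecture-13549, route StarvedNecks) — negative side:
# one-atlas toolkit: where `Ψⱼ = Φ`, the two deviations differ by the Kerr–Schild term

Refuter seat `refuter-cdisprove-stmt-FinalStateConjecture-13549-g3-0` (cdisprove, generation 3),
2026-08-16; workfile `Cruxes/NecksCertify/Disproof.lean` (§G).  Sorry-free, axioms `propext`,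
`Classical.choice`, `Quot.sound`.  Mathlib + the `KerrConvergence` API + the seam rung SFR
(`mfderiv_comp_inclusion_eq` of `StarvedNecksNecksCertifyStubSeamFlatRestrict`); no named facts,
no definitions.

This file is the TOOLKIT (§1 Kerr–Schild data on the spin axis: `r = |λ|`, `H = Mλ/(λ² + a²)`,
`r₊ ≤ 2M`; `g(∂₀,∂₀) = −1 + 2H` is `TameCensorship.Negative.kerrBilin_e0_e0`, inlined here; §2 `C⁰` sup norm ⇒ pointwise operator-norm bound on the deviation;
§3 ONE ATLAS ⇒ `dev Φ − dev Ψ = g_B − η` and `|g_B(v,v) − η(v,v)| ≤ (‖dev Φ‖ + ‖dev Ψ‖)‖v‖²`) for the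
main theorem of `SeamedExcisionUnbounded.lean`, recalled here for orientation:
`excision_tendsto_atTop_of_seamed`: for EVERY `FinalStateDecomposition d` (any `Cᵏ`),
radii `R` and `R₀` satisfying clause (1) of the crux's `Hc` (`100·Mᵢ ≤ R₀`, orthochronous boosts)
and, out of the crux's `Sm`, continuity of `Rᵢ` with `ρᵢ ≥ R₀` (part of S1), ONE ATLAS (S6), S7, S8
and S12, every excision radius tends to infinity: `∀ j, Tendsto (d.excision j) atTop atTop`.
So the growth hypothesis of generation 1's `false_of_parallel_boosts_of_tendsto`
(`NecksCertifyFalseOfEqualVelocityBinaryWitness.lean`, p73407) is AUTOMATIC for seamed outputs, and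
the physics hypothesis `H = EqualVelocityBinaryWitness` of the landed negative lemma can be weakened
to a bare comoving pair (`NecksCertifyFalseOfComovingPairWitness.lean`).

Mechanism (all typed; §4 docstring): if `ρⱼ(s) < b` at a late flat time `s`, then just outside the
tube wall on the pushed spin axis of hole `j` there is an S6-eligible OPEN set (S8 gives
`Rⱼ ≥ ρⱼ + 2` at the wall, continuity of `Rⱼ` keeps the room, S8 + S12 keep the other tubes away,
S7 + `setOf_lt_excision_subset_flatDomain` make eligibility open); there `Ψⱼ = Φ`, hence
(§3, `d(inclusion) = id`) the flat and hole metric deviations differ by the boosted Kerr–Schild term,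
whose `(Λⱼ∂₀, Λⱼ∂₀)` component is `2H = 2Mⱼλ/(λ² + aⱼ²) ≥ 2MⱼR₀/((b+1)² + aⱼ²) > 0` on the axis
(§1), while near-zone convergence of the hole chart at the fixed radius `b + 1` and whole-slab
convergence of the flat chart (structure fields) make both deviations eventually `< ε` (§2).

Reading for provers: the seam's `ρ'` (N2) and every honest one-atlas re-charting MUST have
unbounded flat tubes — not a choice; for the disprover: the only physics left in the comoving
defect is the comoving pair itself (label rigidity), see `ComovingPairWitness`.
-/

noncomputable section

open scoped Manifold ContDiff Topology ENNReal
open Filter Set Literature.Geometry.Lorentzian TopologicalSpace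

namespace Summit.FinalStateConjecture.FinalStateConjecture.Theorems.NecksCertify.Negative

/-! ## §1 Kerr–Schild data on the spin axis -/

/-- On the spin axis `x = x⁰ ∂₀ + λ ∂₃` the spatial norm is `|λ|`. -/
theorem spatialNorm_axis (x₀ l : ℝ) :
    E4.spatialNorm (x₀ • E4.basisVector 0 + l • E4.basisVector 3) = |l| := by
  have hsq := E4.spatialNorm_sq (x₀ • E4.basisVector 0 + l • E4.basisVector 3)
  have e1 : (x₀ • E4.basisVector 0 + l • E4.basisVector 3 : E4) 1 = 0 := by simp
  have e2 : (x₀ • E4.basisVector 0 + l • E4.basisVector 3 : E4) 2 = 0 := by simp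
  have e3 : (x₀ • E4.basisVector 0 + l • E4.basisVector 3 : E4) 3 = l := by simp
  rw [e1, e2, e3] at hsq
  refine (pow_left_inj₀ (E4.spatialNorm_nonneg _) (abs_nonneg l) two_ne_zero).1 ?_
  rw [hsq, sq_abs]
  ring

/-- On the spin axis the Kerr–Schild radius is `|λ|` (`r⁴ − (λ² − a²)r² − a²λ² = (r² − λ²)(r² + a²)`). -/
theorem kerr_radius_axis (a x₀ l : ℝ) :
    Kerr.radius a (x₀ • E4.basisVector 0 + l • E4.basisVector 3) = |l| := by
  have h3 : (x₀ • E4.basisVector 0 + l • E4.basisVector 3 : E4) 3 = l := by simp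
  unfold Kerr.radius
  rw [spatialNorm_axis, h3, sq_abs]
  have h1 : (l ^ 2 - a ^ 2) ^ 2 + 4 * a ^ 2 * l ^ 2 = (l ^ 2 + a ^ 2) ^ 2 := by ring
  rw [h1, Real.sqrt_sq (by positivity)]
  have h2 : (l ^ 2 - a ^ 2 + (l ^ 2 + a ^ 2)) / 2 = l ^ 2 := by ring
  rw [h2, Real.sqrt_sq_eq_abs]

/-- On the spin axis, at height `λ > 0`, the Kerr–Schild scalar is `H = Mλ/(λ² + a²)`. -/
theorem scalarH_axis (M a x₀ : ℝ) {l : ℝ} (hl : 0 < l) :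
    Kerr.scalarH M a (x₀ • E4.basisVector 0 + l • E4.basisVector 3) = M * l / (l ^ 2 + a ^ 2) := by
  have h3 : (x₀ • E4.basisVector 0 + l • E4.basisVector 3 : E4) 3 = l := by simp
  unfold Kerr.scalarH
  rw [kerr_radius_axis, h3, abs_of_pos hl]
  have hl2 : l ^ 2 ≠ 0 := by positivity
  have hden : l ^ 2 + a ^ 2 ≠ 0 := by positivity
  field_simp

/-- Lower bound for `Mλ/(λ² + a²)` on a radius window `[r₁, r₂]`, `0 < r₁`. -/
theorem axis_scalarH_lower {M a r₁ r₂ l : ℝ} (hM : 0 ≤ M) (hr₁ : 0 < r₁) (h₁ : r₁ ≤ l) (h₂ : l ≤ r₂) :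
    M * r₁ / (r₂ ^ 2 + a ^ 2) ≤ M * l / (l ^ 2 + a ^ 2) := by
  have hl : 0 < l := hr₁.trans_le h₁
  have hr₂ : 0 < r₂ := hl.trans_le h₂
  have hA : 0 < l ^ 2 + a ^ 2 := by positivity
  have hB : 0 < r₂ ^ 2 + a ^ 2 := by positivity
  rw [div_le_div_iff₀ hB hA]
  have hl2 : l ^ 2 ≤ r₂ ^ 2 := by nlinarith
  have key : r₁ * (l ^ 2 + a ^ 2) ≤ l * (r₂ ^ 2 + a ^ 2) := by
    nlinarith [mul_le_mul h₁ hl2 (sq_nonneg l) hl.le, mul_le_mul_of_nonneg_right h₁ (sq_nonneg a)]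
  calc M * r₁ * (l ^ 2 + a ^ 2) = M * (r₁ * (l ^ 2 + a ^ 2)) := by ring
    _ ≤ M * (l * (r₂ ^ 2 + a ^ 2)) := mul_le_mul_of_nonneg_left key hM
    _ = M * l * (r₂ ^ 2 + a ^ 2) := by ring

/-- `r₊ = M + √(M² − a²) ≤ 2M` for `M ≥ 0`. -/
theorem rPlus_le_two_mul {M : ℝ} (hM : 0 ≤ M) (a : ℝ) : Kerr.rPlus M a ≤ 2 * M := by
  unfold Kerr.rPlus
  have : √(M ^ 2 - a ^ 2) ≤ M := by
    calc √(M ^ 2 - a ^ 2) ≤ √(M ^ 2) := Real.sqrt_le_sqrt (by nlinarith [sq_nonneg a])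
      _ = M := Real.sqrt_sq hM
  linarith

/-! ## §2 From `C⁰` sup norms to pointwise bounds -/

/-- A `C⁰` sup bound `≤ ENNReal.ofReal ε` on the extended deviation over `S` bounds the operator
norm of the deviation at every point of `S`. -/
theorem norm_deviation_le_of_supCkENorm_le {𝓢 : Spacetime.{0} 4} (B : ModelBackground)
    (Ψ : B.domain → 𝓢.carrier) {S : Set B.domain} {k : ℕ} {ε : ℝ} (hε : 0 ≤ ε)
    (h : supCkENorm (Subtype.val '' S) k (𝓢.deviationExtend B Ψ) ≤ ENNReal.ofReal ε)
    {x : B.domain} (hx : x ∈ S) : ‖𝓢.deviation B Ψ x‖ ≤ ε := by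
  have h0 := enorm_iteratedFDeriv_le_supCkENorm (k := k) (m := 0) (Nat.zero_le k)
    (Set.mem_image_of_mem Subtype.val hx) (𝓢.deviationExtend B Ψ)
  have h1 : ‖iteratedFDeriv ℝ 0 (𝓢.deviationExtend B Ψ) x.1‖ₑ ≤ ENNReal.ofReal ε := h0.trans h
  rw [← ofReal_norm, norm_iteratedFDeriv_zero, 𝓢.deviationExtend_coe,
    ENNReal.ofReal_le_ofReal_iff hε] at h1
  exact h1

/-- `|A v v| ≤ ‖A‖ ‖v‖²` for a continuous bilinear form. -/
theorem abs_bilin_le (A : E4 →L[ℝ] E4 →L[ℝ] ℝ) (v : E4) : |A v v| ≤ ‖A‖ * ‖v‖ ^ 2 := by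
  have := A.le_opNorm₂ v v
  rw [Real.norm_eq_abs] at this
  nlinarith [this]

/-! ## §3 One atlas: where the hole chart is the flat chart, the deviations differ by `g_B − η` -/

open Summit.FinalStateConjecture.FinalStateConjecture.Theorems.NecksCertifyBargmann.FlatRestrict in
/-- **One atlas ⇒ the two deviations differ by `g_B − η`.**  If on an open `W ⊆ E4` contained in
both chart domains a smooth chart `Ψ` (background `B`) and a smooth flat chart `Φ` (Minkowski
background on `U`) agree (clause S6 of `Sm` provides such `W`), then at every `y ∈ W` the flat
deviation minus the `B`-deviation is `g_B(y) − η` (the differentials agree: `d(inclusion) = id`,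
`mfderiv_comp_inclusion_eq`). -/
theorem deviation_sub_deviation_of_agree {𝓢 : Spacetime.{0} 4} (B : ModelBackground)
    (Ψ : B.domain → 𝓢.carrier) (hΨ : ContMDiff 𝓘(ℝ, E4) (𝓡 4) ∞ Ψ) (U : Opens E4)
    (Φ : U → 𝓢.carrier) (hΦ : ContMDiff 𝓘(ℝ, E4) (𝓡 4) ∞ Φ) (W : Opens E4) (hW1 : W ≤ B.domain)
    (hW2 : W ≤ U) (hagree : ∀ (z : E4) (hz : z ∈ W), Ψ ⟨z, hW1 hz⟩ = Φ ⟨z, hW2 hz⟩)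
    {y : E4} (hy : y ∈ W) (v w : E4) :
    𝓢.deviation (Minkowski.backgroundOn U) Φ ⟨y, hW2 hy⟩ v w - 𝓢.deviation B Ψ ⟨y, hW1 hy⟩ v w =
      B.bilin y v w - Minkowski.bilin v w := by
  have hf : Ψ ∘ Opens.inclusion hW1 = Φ ∘ Opens.inclusion hW2 := funext fun p ↦ hagree p.1 p.2
  have key := congrArg (fun f : W → 𝓢.carrier ↦
      𝓢.metric.val (f ⟨y, hy⟩) (mfderiv 𝓘(ℝ, E4) (𝓡 4) f ⟨y, hy⟩ v)
        (mfderiv 𝓘(ℝ, E4) (𝓡 4) f ⟨y, hy⟩ w)) hf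
  rw [mfderiv_comp_inclusion_eq hW1 ((hΨ _).mdifferentiableAt (by simp)),
    mfderiv_comp_inclusion_eq hW2 ((hΦ _).mdifferentiableAt (by simp))] at key
  rw [Spacetime.deviation_apply, Spacetime.deviation_apply]
  change 𝓢.metric.val (Ψ ⟨y, hW1 hy⟩) (mfderiv 𝓘(ℝ, E4) (𝓡 4) Ψ ⟨y, hW1 hy⟩ v)
      (mfderiv 𝓘(ℝ, E4) (𝓡 4) Ψ ⟨y, hW1 hy⟩ w) =
    𝓢.metric.val (Φ ⟨y, hW2 hy⟩) (mfderiv 𝓘(ℝ, E4) (𝓡 4) Φ ⟨y, hW2 hy⟩ v)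
      (mfderiv 𝓘(ℝ, E4) (𝓡 4) Φ ⟨y, hW2 hy⟩ w) at key
  change 𝓢.metric.val (Φ ⟨y, hW2 hy⟩) (mfderiv 𝓘(ℝ, E4) (𝓡 4) Φ ⟨y, hW2 hy⟩ v)
        (mfderiv 𝓘(ℝ, E4) (𝓡 4) Φ ⟨y, hW2 hy⟩ w) - Minkowski.bilin v w -
      (𝓢.metric.val (Ψ ⟨y, hW1 hy⟩) (mfderiv 𝓘(ℝ, E4) (𝓡 4) Ψ ⟨y, hW1 hy⟩ v)
        (mfderiv 𝓘(ℝ, E4) (𝓡 4) Ψ ⟨y, hW1 hy⟩ w) - B.bilin y v w) = B.bilin y v w - Minkowski.bilin v w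
  rw [key]
  ring

/-- **One atlas ⇒ `|g_B(y)(v,v) − η(v,v)| ≤ (‖dev Φ (y)‖ + ‖dev Ψ (y)‖)·‖v‖²`.** -/
theorem abs_sub_bilin_le_of_agree {𝓢 : Spacetime.{0} 4} (B : ModelBackground)
    (Ψ : B.domain → 𝓢.carrier) (hΨ : ContMDiff 𝓘(ℝ, E4) (𝓡 4) ∞ Ψ) (U : Opens E4)
    (Φ : U → 𝓢.carrier) (hΦ : ContMDiff 𝓘(ℝ, E4) (𝓡 4) ∞ Φ) (W : Opens E4) (hW1 : W ≤ B.domain)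
    (hW2 : W ≤ U) (hagree : ∀ (z : E4) (hz : z ∈ W), Ψ ⟨z, hW1 hz⟩ = Φ ⟨z, hW2 hz⟩)
    {y : E4} (hy : y ∈ W) (v : E4) :
    |B.bilin y v v - Minkowski.bilin v v| ≤
      (‖𝓢.deviation (Minkowski.backgroundOn U) Φ ⟨y, hW2 hy⟩‖ + ‖𝓢.deviation B Ψ ⟨y, hW1 hy⟩‖) *
        ‖v‖ ^ 2 := by
  rw [← deviation_sub_deviation_of_agree B Ψ hΨ U Φ hΦ W hW1 hW2 hagree hy v v]
  have h1 := abs_bilin_le (𝓢.deviation (Minkowski.backgroundOn U) Φ ⟨y, hW2 hy⟩) v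
  have h2 := abs_bilin_le (𝓢.deviation B Ψ ⟨y, hW1 hy⟩) v
  calc _ ≤ |𝓢.deviation (Minkowski.backgroundOn U) Φ ⟨y, hW2 hy⟩ v v| +
        |𝓢.deviation B Ψ ⟨y, hW1 hy⟩ v v| := abs_sub _ _
    _ ≤ _ := by nlinarith [h1, h2]

/-- The boosted Kerr–Schild term on the pushed time axis:
`g_{Λ,c,M,a}(y)(Λ∂₀, Λ∂₀) − η(Λ∂₀, Λ∂₀) = 2H(Λ⁻¹(y − c))`. -/
theorem boostedKerrBilin_sub_bilin_lorentz_basisVector_zero (Λ : lorentzGroup) (c : E4) (M a : ℝ)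
    (y : E4) :
    boostedKerrBilin Λ c M a y ((Λ : E4 ≃L[ℝ] E4) (E4.basisVector 0))
        ((Λ : E4 ≃L[ℝ] E4) (E4.basisVector 0)) -
      Minkowski.bilin ((Λ : E4 ≃L[ℝ] E4) (E4.basisVector 0)) ((Λ : E4 ≃L[ℝ] E4) (E4.basisVector 0)) =
      2 * Kerr.scalarH M a (poincareInv Λ c y) := by
  rw [boostedKerrBilin_apply, ContinuousLinearEquiv.symm_apply_apply, Kerr.bilin_apply,
    Kerr.nullCovector_basisVector_zero, Λ.2, Minkowski.bilin_basisVector_zero]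
  ring

end Summit.FinalStateConjecture.FinalStateConjecture.Theorems.NecksCertify.Negative

end
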